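/-
Copyright: cell pub-balaban-gaps (YM BLITZ Y1, track G1), seat g1-p2 GEN 12 (unit `pub-balaban-gaps-g1-p2`).  Row (D4) NODE O,
MECHANISM level — ROAD (c′) of g1-plan-1 GEN 39 ([G1-PLAN1-G39-PRECISION-110] (ψ3)–(ψ4), step (vi)): the SEED terms
`fibD(h_□ĝ_□⁻¹)·G′_□·fibD(h_□ĝ_□)` and the STEP terms `fibD ĝ_□⁻¹·[h_□⊗1, Δ′_□]G′_□·fibD(h_□ĝ_□)` of (3.87)–(3.88) in block currency:
where their blocks live (the sparsity of `Δ_W + m² + a_KP_K(U)`), and the K-FREE block letter of `[h⊗1, Δ′_□]·T` from (3.88)'s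
first-order shape (125) and the value ∕ difference letters of `T`.  HONEST FRAMING: [folklore] bookkeeping over 59b ∕ 63 ∕ 64 ∕ 124 ∕ 125;
`h`, the defects, the averaging kernel and `T` are data; nothing of Bałaban's `Δ^{(k)}(𝐔)` is constructed; words of row (D4) UNCHANGED
(`ExistsUniformAcrossSmall` + `TermDomination`, OBJECT level); (D4) instance 0∕1; NOT BetaPertH, NOT continuum, NOT Clay.
-/
import Summits.QuantumFields.BalabanUV.Gaps.D4WalkBlockCommutator388
import Summits.QuantumFields.BalabanUV.Gaps.D4WalkBlockConjugate

/-!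
# `Gaps.D4WalkBlockSeedTerms` — sparsity of the one-scale covariant operator, the support of `[h⊗1, Δ′]`, and the K-free block
# letter of `[h⊗1, Δ′]·T` (cell pub-balaban-gaps, seat g1-p2 gen 12)

HONEST DEPENDENCY (cell pub-balaban, verbatim): continuum YM on T⁴ ⇐ BetaPertH ∧ nine spine estimates (0/9 proved);
BetaPertH ⇐ (D1) ∧ (D4) ∧ CAP+tail.

[B9] (3.88)–(3.89) p. 409: the step operator `K(h_□)G′_□h_□` is `O(M⁻¹)` because `[h_□, Δ′]` is first order with `∇h_□ = O(M⁻¹)`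
coefficients and the propagators carry the derivative entries of (3.42) (Cor. 3.6 p. 408).
* §1 SPARSITY: `two_smul_one_apply`, `covLap_apply_eq_zero` (the entry `(p,q)` of `Δ_W` vanishes unless `p.1 = q.1` or `p.1 = q.1 ∓ e_μ`),
  `covOp_apply_eq_zero`, **`commutator_row_eq_zero`** (a row of `[h⊗1, Δ′]` at a site where `h` and its `2d` neighbours and block-mates
  vanish is zero), `fibD_offCube`, `commutator_PU_offCube` (cube-locality for `blockNorm_local_mul_le`).
* §2 ROW SUMS of the pieces: `rowSum_one_add_fibDiag_le` (`≤ 1 + ηβ`), `rowSum_wOp_le` (`≤ |w|_∞`), `commutator_covOp_eq`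
  (`[h⊗1, Δ_W + m² + a_KP] = [h⊗1, Δ_W] + a_K[h⊗1, P]`).
* §3 **`blockNorm_commutator_covOp_mul_le`**: with `|∇^±h| ≤ δ₁`, `|Δ^ηh| ≤ Λ`, windows `Σ_b‖W^±(x)_{ab}‖ ≤ ηβ`, an averaging kernel
  living in the unit blocks with rows `≤ π` on which `h` oscillates by `≤ ω`, and a kernel `T` with `‖T‖_{y,y′} ≤ F(y,y′)`,
  `‖covDop_ι T‖_{y,y′} ≤ B_ιF(y,y′)`:
  `‖[h⊗1, Δ′]T‖_{y,y′} ≤ (Σ_μ (1 + ηβ)δ₁(B_{inl μ} + B_{inr μ}) + d(Λ + 2δ₁β) + |a_K|ωπ)·F(y,y′)` — every letter K-free.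
WHAT IT IS NOT.  The kernel shapes and the block walk expansions themselves (126 + 127 + 55), the END of road (c′): next files; OBJECT level untouched.

References (method only): T. Bałaban, Comm. Math. Phys. **99** (1985) 389–434 [B9], (3.8) p. 392, (3.50) p. 400, Cor. 3.6 p. 408,
(3.87)–(3.89) p. 409, (3.108) p. 416.
-/

noncomputable section

namespace Summit.QuantumFields.BalabanUV.Gaps.D4WalkBlockSeedTerms

open Finset Complex Matrix
open scoped BigOperators Matrix
open Literature.MathematicalPhysics.QuantumFieldTheory.Balaban1983to89
open Literature.MathematicalPhysics.QuantumFieldTheory.Balaban1983to89.B5TorusCover (UT)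
open Literature.MathematicalPhysics.QuantumFieldTheory.Balaban1983to89.B5Ineq137Torus (Nv blk)
open Summit.QuantumFields.BalabanUV.Gaps.D4WalkBlock (blockNorm blockNorm_nonneg blockNorm_add_le blockNorm_smul_le)
open Summit.QuantumFields.BalabanUV.Gaps.D4WalkBlockDerivative (blockNorm_sum_le)
open Summit.QuantumFields.BalabanUV.Gaps.D4WalkBlockConjugate (blockNorm_local_mul_le)
open Summit.QuantumFields.BalabanUV.Gaps.D4WalkBlockFlatLetters (cubeOf cubeOf_eq_iff)
open Summit.QuantumFields.BalabanUV.Gaps.D4WalkBlockShiftAlgebra (fibD fibD_local)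
open Summit.QuantumFields.BalabanUV.Gaps.D4WalkBlockShiftWeighted (wOp wOp_mul_apply)
open Summit.QuantumFields.BalabanUV.Gaps.D4WalkBlockGaugeAlgebra (rowSum_fibD)
open Summit.QuantumFields.BalabanUV.Gaps.D4WalkBlockCovariantGeometry (fibDiag SBf shift_unshift)
open Summit.QuantumFields.BalabanUV.Gaps.D4WalkBlockCovariantShift (Sf covDop covLap)
open Summit.QuantumFields.BalabanUV.Gaps.D4WalkBlockCovariantPropagator (covOp unshift_shift)
open Summit.QuantumFields.BalabanUV.Gaps.D4WalkBlockCovariantBlockAveraging (PU)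
open Summit.QuantumFields.BalabanUV.Gaps.D4WalkBlockFormGaugeTorus (fibDiag_eq_fibD one_add_fibD)
open Summit.QuantumFields.BalabanUV.Gaps.D4WalkBlockSeedResummation
  (wOp_commutator_apply mul_Sf_apply mul_SBf_apply one_add_fibDiag_apply PU_apply)
open Summit.QuantumFields.BalabanUV.Gaps.D4WalkBlockCommutator388
  (commutator_covLap_firstOrder rowSum_one_fibre rowSum_zeroth_le zeroth_eq_fibDiag rowSum_commutator_le_of_osc)

variable (P : Params) (F : Type) [Fintype F] [DecidableEq F]
variable {E : Type*}

/-! ## §1. Sparsity of `Δ_W + m² + a_KP_K(U)` and the support of the commutator's rows -/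

section Sparsity
variable (Wp Wm : Fin P.d → E → Site P 0 → Matrix F F ℂ) (PUo : E → Matrix (Site P 0 × F) (Site P 0 × F) ℂ) (a msq : ℝ)

omit [Fintype F] in
/-- entries of `2•1`. ([folklore]) -/
theorem two_smul_one_apply (p q : Site P 0 × F) (h0 : p ≠ q) :
    ((2 : ℂ) • (1 : Matrix (Site P 0 × F) (Site P 0 × F) ℂ)) p q = 0 := by
  rw [Matrix.smul_apply, Matrix.one_apply_ne h0, smul_zero]

/-- **SPARSITY OF `Δ_W`**: the entry `(p, q)` vanishes unless `p.1 = q.1`, `p.1 = q.1 − e_μ` or `p.1 = q.1 + e_μ` for some `μ`.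
[cite: Balaban1985BackgroundPropagators, (3.50) p.400] -/
theorem covLap_apply_eq_zero (u : E) (p q : Site P 0 × F) (h0 : p.1 ≠ q.1) (h1 : ∀ μ, p.1 ≠ Site.unshift q.1 μ)
    (h2 : ∀ μ, p.1 ≠ Site.shift q.1 μ) : covLap P F Wp Wm u p q = 0 := by
  have hpq : p ≠ q := fun e => h0 (by rw [e])
  unfold covLap
  rw [Matrix.smul_apply, Matrix.sum_apply]
  refine smul_eq_zero_of_right _ (Finset.sum_eq_zero fun μ _ => ?_)
  rw [Matrix.sub_apply, Matrix.sub_apply, two_smul_one_apply P F p q hpq, mul_Sf_apply, mul_SBf_apply, one_add_fibDiag_apply,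
    one_add_fibDiag_apply, if_neg (h1 μ), if_neg (h2 μ), sub_zero, sub_zero]

/-- **SPARSITY OF `Δ_W + m² + a_KP`** for an averaging kernel `P` living in the unit blocks. [cite: Balaban1985BackgroundPropagators, (3.8) p.392, (3.50) p.400] -/
theorem covOp_apply_eq_zero (hPUloc : ∀ u (p q : Site P 0 × F), PUo u p q ≠ 0 → blk P P.K p.1 = blk P P.K q.1) (u : E)
    (p q : Site P 0 × F) (h1 : ∀ μ, p.1 ≠ Site.unshift q.1 μ) (h2 : ∀ μ, p.1 ≠ Site.shift q.1 μ)
    (hb : blk P P.K p.1 ≠ blk P P.K q.1) : covOp P F Wp Wm PUo a msq u p q = 0 := by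
  have h0 : p.1 ≠ q.1 := fun e => hb (by rw [e])
  have hpq : p ≠ q := fun e => h0 (by rw [e])
  have hP : PUo u p q = 0 := by by_contra hne; exact hb (hPUloc u p q hne)
  unfold covOp
  rw [Matrix.add_apply, Matrix.add_apply, Matrix.smul_apply, Matrix.smul_apply, covLap_apply_eq_zero P F Wp Wm u p q h0 h1 h2,
    Matrix.one_apply_ne hpq, hP, smul_zero, smul_zero, add_zero, add_zero]

/-- **THE ROWS OF `[h⊗1, Δ′]` LIVE NEXT TO `supp h`**: at a site where `h`, its `2d` lattice neighbours and its block-mates vanish, the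
whole row of the commutator is zero (print: `K(h_□)` is supported near `supp ∇h_□`). [cite: Balaban1985BackgroundPropagators, (3.88) p.409] -/
theorem commutator_row_eq_zero (hPUloc : ∀ u (p q : Site P 0 × F), PUo u p q ≠ 0 → blk P P.K p.1 = blk P P.K q.1)
    (h : Site P 0 → ℝ) (u : E) (p : Site P 0 × F) (hn1 : ∀ μ, h (Site.shift p.1 μ) = 0) (hn2 : ∀ μ, h (Site.unshift p.1 μ) = 0)
    (hbl : ∀ x, blk P P.K x = blk P P.K p.1 → h x = 0) (q : Site P 0 × F) :
    (wOp (Site P 0) F h * covOp P F Wp Wm PUo a msq u - covOp P F Wp Wm PUo a msq u * wOp (Site P 0) F h) p q = 0 := by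
  have hp : h p.1 = 0 := hbl p.1 rfl
  rw [wOp_commutator_apply, hp, zero_sub]
  by_cases hc : covOp P F Wp Wm PUo a msq u p q = 0
  · rw [hc, mul_zero]
  · have hq : h q.1 = 0 := by
      by_contra hq
      refine hc (covOp_apply_eq_zero P F Wp Wm PUo a msq hPUloc u p q (fun μ e => hq ?_) (fun μ e => hq ?_) (fun e => hq ?_))
      · have e' : q.1 = Site.shift p.1 μ := by rw [e, shift_unshift]
        rw [e']; exact hn1 μ
      · have e' : q.1 = Site.unshift p.1 μ := by rw [e, unshift_shift]
        rw [e']; exact hn2 μ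
      · exact hbl q.1 e.symm
    rw [hq, neg_zero, Complex.ofReal_zero, zero_mul]

omit [Fintype F] [DecidableEq F] in
/-- a site-diagonal operator couples only indices in one cube. ([folklore]) -/
theorem fibD_offCube (w : Site P 0 → Matrix F F ℂ) (i j : Site P 0 × F) (hne : cubeOf P i.1 ≠ cubeOf P j.1) :
    fibD (Site P 0) F w i j = 0 := by
  by_contra h0; exact hne (fibD_local (cubeOf P) w i j h0)

/-- the commutator with a block-local averaging kernel couples only indices in one cube. ([folklore]) -/
theorem commutator_PU_offCube (hPUloc : ∀ u (p q : Site P 0 × F), PUo u p q ≠ 0 → blk P P.K p.1 = blk P P.K q.1)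
    (h : Site P 0 → ℝ) (u : E) (i j : Site P 0 × F) (hne : cubeOf P i.1 ≠ cubeOf P j.1) :
    (wOp (Site P 0) F h * PUo u - PUo u * wOp (Site P 0) F h) i j = 0 := by
  rw [wOp_commutator_apply]
  by_cases h0 : PUo u i j = 0
  · rw [h0, mul_zero]
  · exact (hne (cubeOf_eq_iff.2 (hPUloc u i j h0))).elim

variable (Ug Ugi : E → Site P 0 → Matrix F F ℂ)

omit [DecidableEq F] in
/-- 64's genuine projector lives in the unit blocks. [cite: Balaban1985BackgroundPropagators, (3.8) p.392] -/
theorem PU_blockLocal (u : E) (p q : Site P 0 × F) (h : PU P F Ug Ugi u p q ≠ 0) : blk P P.K p.1 = blk P P.K q.1 := by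
  by_contra hb; rw [PU_apply, if_neg hb] at h; exact h rfl

end Sparsity

/-! ## §2. Row sums of the pieces; `[h⊗1, Δ_W + m² + a_KP] = [h⊗1, Δ_W] + a_K[h⊗1, P]` -/

section RowSums

/-- row sums of `1 + fibDiag W` from the window `Σ_b‖W(x)_{ab}‖ ≤ ηβ`. ([folklore]) -/
theorem rowSum_one_add_fibDiag_le (W : Site P 0 → Matrix F F ℂ) {β : ℝ} (hW : ∀ x a', ∑ b, ‖W x a' b‖ ≤ P.eps * β)
    (p : Site P 0 × F) : ∑ q, ‖(1 + fibDiag P F W) p q‖ ≤ 1 + P.eps * β := by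
  rw [fibDiag_eq_fibD, one_add_fibD, rowSum_fibD]
  calc ∑ b, ‖(1 + W p.1) p.2 b‖ ≤ ∑ b, (‖(1 : Matrix F F ℂ) p.2 b‖ + ‖W p.1 p.2 b‖) :=
        Finset.sum_le_sum fun b _ => by rw [Matrix.add_apply]; exact norm_add_le _ _
    _ = 1 + ∑ b, ‖W p.1 p.2 b‖ := by rw [Finset.sum_add_distrib, rowSum_one_fibre]
    _ ≤ 1 + P.eps * β := by linarith [hW p.1 p.2]

/-- row sums of a weight `w ⊗ 1` are `|w(x)|`. ([folklore]) -/
theorem rowSum_wOp_le (w : Site P 0 → ℝ) {δ : ℝ} (hw : ∀ x, |w x| ≤ δ) (p : Site P 0 × F) :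
    ∑ q, ‖wOp (Site P 0) F w p q‖ ≤ δ := by
  unfold wOp
  rw [rowSum_fibD]
  calc ∑ b, ‖((((w p.1 : ℝ) : ℂ)) • (1 : Matrix F F ℂ)) p.2 b‖ = |w p.1| * ∑ b, ‖(1 : Matrix F F ℂ) p.2 b‖ := by
        rw [Finset.mul_sum]
        exact Finset.sum_congr rfl fun b _ => by
          rw [Matrix.smul_apply, smul_eq_mul, norm_mul, Complex.norm_real, Real.norm_eq_abs]
    _ = |w p.1| := by rw [rowSum_one_fibre, mul_one]
    _ ≤ δ := hw p.1

variable (Wp Wm : Fin P.d → E → Site P 0 → Matrix F F ℂ) (PUo : E → Matrix (Site P 0 × F) (Site P 0 × F) ℂ) (a msq : ℝ)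

/-- `[h⊗1, Δ_W + m² + a_KP] = [h⊗1, Δ_W] + a_K·[h⊗1, P]` (the mass commutes). [cite: Balaban1985BackgroundPropagators, (3.88) p.409] -/
theorem commutator_covOp_eq (u : E) (h : Site P 0 → ℝ) :
    wOp (Site P 0) F h * covOp P F Wp Wm PUo a msq u - covOp P F Wp Wm PUo a msq u * wOp (Site P 0) F h
      = (wOp (Site P 0) F h * covLap P F Wp Wm u - covLap P F Wp Wm u * wOp (Site P 0) F h)
        + (B1RG242Torus.α P a P.K : ℂ) • (wOp (Site P 0) F h * PUo u - PUo u * wOp (Site P 0) F h) := by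
  unfold covOp
  rw [Matrix.mul_add, Matrix.mul_add, Matrix.add_mul, Matrix.add_mul, Matrix.mul_smul, Matrix.smul_mul, Matrix.mul_smul,
    Matrix.smul_mul, Matrix.mul_one, Matrix.one_mul, smul_sub]
  abel

end RowSums

/-! ## §3. The K-free block letter of `[h⊗1, Δ′]·T` -/

section Letter
variable (Wp Wm : Fin P.d → E → Site P 0 → Matrix F F ℂ) (PUo : E → Matrix (Site P 0 × F) (Site P 0 × F) ℂ) (a msq : ℝ)

/-- **THE BLOCK LETTER OF THE STEP OPERATOR `[h⊗1, Δ′]·T`** (print's (3.89) `O(M⁻¹)`, K-free).  Data: `|∇⁺_μh|, |∇⁻_μh| ≤ δ₁`,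
`|Δ^η_μh| ≤ Λ`; defect windows `Σ_b‖W^±_μ(u,x)_{ab}‖ ≤ ηβ`; an averaging kernel living in the unit blocks, rows `≤ π`, on whose support
`h` oscillates by `≤ ω`; a kernel `T` with block bound `F` and relative `covDop` letters `B_ι`.  Then for all cubes
`‖[h⊗1, Δ_W + m² + a_KP]·T‖_{y,y′} ≤ (Σ_μ (1 + ηβ)δ₁(B_{inl μ} + B_{inr μ}) + d(Λ + δ₁β + δ₁β) + |a_K|ωπ)·F(y,y′)`.
[cite: Balaban1985BackgroundPropagators, (3.88)–(3.89) p.409, Cor. 3.6 p.408, (3.108) p.416] -/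
theorem blockNorm_commutator_covOp_mul_le (h : Site P 0 → ℝ) (u : E) {δ₁ Λ β ω π : ℝ} (hδ₁ : 0 ≤ δ₁) (hΛ : 0 ≤ Λ)
    (hβ : 0 ≤ β) (hω : 0 ≤ ω) (hπ : 0 ≤ π)
    (hdp : ∀ μ y, |P.eps⁻¹ * (h (Site.shift y μ) - h y)| ≤ δ₁) (hdm : ∀ μ y, |P.eps⁻¹ * (h y - h (Site.unshift y μ))| ≤ δ₁)
    (hlap : ∀ μ y, |(P.eps⁻¹) ^ 2 * (h (Site.shift y μ) - 2 * h y + h (Site.unshift y μ))| ≤ Λ)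
    (hWp : ∀ μ x a', ∑ b, ‖Wp μ u x a' b‖ ≤ P.eps * β) (hWm : ∀ μ x a', ∑ b, ‖Wm μ u x a' b‖ ≤ P.eps * β)
    (hPUloc : ∀ u (p q : Site P 0 × F), PUo u p q ≠ 0 → blk P P.K p.1 = blk P P.K q.1)
    (hosc : ∀ p q : Site P 0 × F, PUo u p q ≠ 0 → |h p.1 - h q.1| ≤ ω) (hPUrow : ∀ p, ∑ q, ‖PUo u p q‖ ≤ π)
    (T : Matrix (Site P 0 × F) (Site P 0 × F) ℂ) {Fb : UT (Nv P P.K) → UT (Nv P P.K) → ℝ} {Bι : Fin P.d ⊕ Fin P.d → ℝ}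
    (hT : ∀ y y', blockNorm (fun q : Site P 0 × F => cubeOf P q.1) (fun q => cubeOf P q.1) T y y' ≤ Fb y y')
    (hDT : ∀ ι y y', blockNorm (fun q : Site P 0 × F => cubeOf P q.1) (fun q => cubeOf P q.1) (covDop P F ι * T) y y' ≤
      Bι ι * Fb y y') (y y' : UT (Nv P P.K)) :
    blockNorm (fun q : Site P 0 × F => cubeOf P q.1) (fun q => cubeOf P q.1)
        ((wOp (Site P 0) F h * covOp P F Wp Wm PUo a msq u - covOp P F Wp Wm PUo a msq u * wOp (Site P 0) F h) * T) y y'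
      ≤ ((∑ μ : Fin P.d, (1 + P.eps * β) * δ₁ * (Bι (Sum.inl μ) + Bι (Sum.inr μ))) + (P.d : ℝ) * (Λ + δ₁ * β + δ₁ * β)
          + |B1RG242Torus.α P a P.K| * (ω * π)) * Fb y y' := by
  set cq : Site P 0 × F → UT (Nv P P.K) := fun q => cubeOf P q.1 with hcq
  have hε : 0 < P.eps := P.eps_pos
  have hηβ : 0 ≤ 1 + P.eps * β := by positivity
  -- the three pieces
  set Cp : Fin P.d → Matrix (Site P 0 × F) (Site P 0 × F) ℂ := fun μ =>
    (1 + fibDiag P F (Wp μ u)) * (wOp (Site P 0) F (fun y => P.eps⁻¹ * (h (Site.shift y μ) - h y)) * covDop P F (Sum.inl μ))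
    with hCp
  set Cm : Fin P.d → Matrix (Site P 0 × F) (Site P 0 × F) ℂ := fun μ =>
    (1 + fibDiag P F (Wm μ u)) * (wOp (Site P 0) F (fun y => P.eps⁻¹ * (h y - h (Site.unshift y μ))) * covDop P F (Sum.inr μ))
    with hCm
  set Z : Fin P.d → Matrix (Site P 0 × F) (Site P 0 × F) ℂ := fun μ =>
    wOp (Site P 0) F (fun y => (P.eps⁻¹) ^ 2 * (h (Site.shift y μ) - 2 * h y + h (Site.unshift y μ)))
      + (P.eps⁻¹ : ℂ) • (fibDiag P F (Wp μ u) * wOp (Site P 0) F (fun y => P.eps⁻¹ * (h (Site.shift y μ) - h y))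
          - fibDiag P F (Wm μ u) * wOp (Site P 0) F (fun y => P.eps⁻¹ * (h y - h (Site.unshift y μ)))) with hZ
  set Cav : Matrix (Site P 0 × F) (Site P 0 × F) ℂ := wOp (Site P 0) F h * PUo u - PUo u * wOp (Site P 0) F h with hCav
  have hdec : (wOp (Site P 0) F h * covOp P F Wp Wm PUo a msq u - covOp P F Wp Wm PUo a msq u * wOp (Site P 0) F h) * T
      = (∑ μ, (Cp μ * T + Cm μ * T) + ∑ μ, Z μ * T) + (B1RG242Torus.α P a P.K : ℂ) • (Cav * T) := by
    rw [commutator_covOp_eq, commutator_covLap_firstOrder, Matrix.add_mul, Matrix.add_mul, Finset.sum_mul, Finset.sum_mul,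
      Matrix.smul_mul]
    simp only [hCp, hCm, hZ, hCav, Matrix.add_mul]
  -- piece 1: the first-order terms
  have h1 : ∀ μ, blockNorm cq cq (Cp μ * T) y y' ≤ (1 + P.eps * β) * δ₁ * Bι (Sum.inl μ) * Fb y y' := by
    intro μ
    rw [hCp]
    simp only [Matrix.mul_assoc]
    calc blockNorm cq cq ((1 + fibDiag P F (Wp μ u)) * (wOp (Site P 0) F (fun y => P.eps⁻¹ * (h (Site.shift y μ) - h y)) *
            (covDop P F (Sum.inl μ) * T))) y y'
        ≤ (1 + P.eps * β) * blockNorm cq cq (wOp (Site P 0) F (fun y => P.eps⁻¹ * (h (Site.shift y μ) - h y)) *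
            (covDop P F (Sum.inl μ) * T)) y y' := by
          refine blockNorm_local_mul_le cq cq _ (fun i j hne => ?_) hηβ (rowSum_one_add_fibDiag_le P F _ (hWp μ)) _ y y'
          rw [fibDiag_eq_fibD, one_add_fibD]; exact fibD_offCube P F _ i j hne
      _ ≤ (1 + P.eps * β) * (δ₁ * blockNorm cq cq (covDop P F (Sum.inl μ) * T) y y') := by
          refine mul_le_mul_of_nonneg_left ?_ hηβ
          refine blockNorm_local_mul_le cq cq _ (fun i j hne => ?_) hδ₁ (rowSum_wOp_le P F _ (hdp μ)) _ y y'
          unfold wOp; exact fibD_offCube P F _ i j hne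
      _ ≤ (1 + P.eps * β) * (δ₁ * (Bι (Sum.inl μ) * Fb y y')) :=
          mul_le_mul_of_nonneg_left (mul_le_mul_of_nonneg_left (hDT _ y y') hδ₁) hηβ
      _ = (1 + P.eps * β) * δ₁ * Bι (Sum.inl μ) * Fb y y' := by ring
  have h2 : ∀ μ, blockNorm cq cq (Cm μ * T) y y' ≤ (1 + P.eps * β) * δ₁ * Bι (Sum.inr μ) * Fb y y' := by
    intro μ
    rw [hCm]
    simp only [Matrix.mul_assoc]
    calc blockNorm cq cq ((1 + fibDiag P F (Wm μ u)) * (wOp (Site P 0) F (fun y => P.eps⁻¹ * (h y - h (Site.unshift y μ))) *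
            (covDop P F (Sum.inr μ) * T))) y y'
        ≤ (1 + P.eps * β) * blockNorm cq cq (wOp (Site P 0) F (fun y => P.eps⁻¹ * (h y - h (Site.unshift y μ))) *
            (covDop P F (Sum.inr μ) * T)) y y' := by
          refine blockNorm_local_mul_le cq cq _ (fun i j hne => ?_) hηβ (rowSum_one_add_fibDiag_le P F _ (hWm μ)) _ y y'
          rw [fibDiag_eq_fibD, one_add_fibD]; exact fibD_offCube P F _ i j hne
      _ ≤ (1 + P.eps * β) * (δ₁ * blockNorm cq cq (covDop P F (Sum.inr μ) * T) y y') := by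
          refine mul_le_mul_of_nonneg_left ?_ hηβ
          refine blockNorm_local_mul_le cq cq _ (fun i j hne => ?_) hδ₁ (rowSum_wOp_le P F _ (hdm μ)) _ y y'
          unfold wOp; exact fibD_offCube P F _ i j hne
      _ ≤ (1 + P.eps * β) * (δ₁ * (Bι (Sum.inr μ) * Fb y y')) :=
          mul_le_mul_of_nonneg_left (mul_le_mul_of_nonneg_left (hDT _ y y') hδ₁) hηβ
      _ = (1 + P.eps * β) * δ₁ * Bι (Sum.inr μ) * Fb y y' := by ring
  -- piece 2: the zeroth-order remainder
  have h3 : ∀ μ, blockNorm cq cq (Z μ * T) y y' ≤ (Λ + δ₁ * β + δ₁ * β) * Fb y y' := by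
    intro μ
    have hrow := rowSum_zeroth_le P F (Wp μ u) (Wm μ u) _ _ _ hδ₁ hδ₁ (hlap μ) (hdp μ) (hdm μ) (hWp μ) (hWm μ)
    calc blockNorm cq cq (Z μ * T) y y' ≤ (Λ + δ₁ * β + δ₁ * β) * blockNorm cq cq T y y' := by
          refine blockNorm_local_mul_le cq cq _ (fun i j hne => ?_) (by positivity) hrow _ y y'
          rw [zeroth_eq_fibDiag]; exact fibD_offCube P F _ i j hne
      _ ≤ (Λ + δ₁ * β + δ₁ * β) * Fb y y' := mul_le_mul_of_nonneg_left (hT y y') (by positivity)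
  -- piece 3: the averaging commutator
  have h4 : blockNorm cq cq (Cav * T) y y' ≤ ω * π * Fb y y' := by
    have hrow : ∀ p, ∑ q, ‖Cav p q‖ ≤ ω * π := fun p => by
      rw [hCav]
      calc ∑ q, ‖(wOp (Site P 0) F h * PUo u - PUo u * wOp (Site P 0) F h) p q‖ ≤ ω * ∑ q, ‖PUo u p q‖ :=
            rowSum_commutator_le_of_osc P F h (PUo u) hosc p Finset.univ
        _ ≤ ω * π := mul_le_mul_of_nonneg_left (hPUrow p) hω
    calc blockNorm cq cq (Cav * T) y y' ≤ ω * π * blockNorm cq cq T y y' :=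
          blockNorm_local_mul_le cq cq _ (fun i j hne => commutator_PU_offCube P F PUo hPUloc h u i j hne) (by positivity) hrow _ y y'
      _ ≤ ω * π * Fb y y' := mul_le_mul_of_nonneg_left (hT y y') (by positivity)
  -- assemble
  rw [hdec]
  calc blockNorm cq cq ((∑ μ, (Cp μ * T + Cm μ * T) + ∑ μ, Z μ * T) + (B1RG242Torus.α P a P.K : ℂ) • (Cav * T)) y y'
      ≤ blockNorm cq cq (∑ μ, (Cp μ * T + Cm μ * T) + ∑ μ, Z μ * T) y y' +
          blockNorm cq cq ((B1RG242Torus.α P a P.K : ℂ) • (Cav * T)) y y' := blockNorm_add_le cq cq _ _ y y'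
    _ ≤ (blockNorm cq cq (∑ μ, (Cp μ * T + Cm μ * T)) y y' + blockNorm cq cq (∑ μ, Z μ * T) y y') +
          ‖(B1RG242Torus.α P a P.K : ℂ)‖ * blockNorm cq cq (Cav * T) y y' :=
        add_le_add (blockNorm_add_le cq cq _ _ y y') (blockNorm_smul_le cq cq _ _ y y')
    _ ≤ ((∑ μ, (blockNorm cq cq (Cp μ * T) y y' + blockNorm cq cq (Cm μ * T) y y')) + ∑ μ, blockNorm cq cq (Z μ * T) y y') +
          |B1RG242Torus.α P a P.K| * (ω * π * Fb y y') := by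
        refine add_le_add (add_le_add ((blockNorm_sum_le cq cq _ _ y y').trans (Finset.sum_le_sum fun μ _ =>
          blockNorm_add_le cq cq _ _ y y')) (blockNorm_sum_le cq cq _ _ y y')) ?_
        rw [Complex.norm_real, Real.norm_eq_abs]
        exact mul_le_mul_of_nonneg_left h4 (abs_nonneg _)
    _ ≤ ((∑ μ, ((1 + P.eps * β) * δ₁ * Bι (Sum.inl μ) * Fb y y' + (1 + P.eps * β) * δ₁ * Bι (Sum.inr μ) * Fb y y')) +
          ∑ _μ : Fin P.d, (Λ + δ₁ * β + δ₁ * β) * Fb y y') + |B1RG242Torus.α P a P.K| * (ω * π * Fb y y') :=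
        add_le_add (add_le_add (Finset.sum_le_sum fun μ _ => add_le_add (h1 μ) (h2 μ)) (Finset.sum_le_sum fun μ _ => h3 μ)) le_rfl
    _ = ((∑ μ : Fin P.d, (1 + P.eps * β) * δ₁ * (Bι (Sum.inl μ) + Bι (Sum.inr μ))) + (P.d : ℝ) * (Λ + δ₁ * β + δ₁ * β)
          + |B1RG242Torus.α P a P.K| * (ω * π)) * Fb y y' := by
        rw [Finset.sum_const, Finset.card_univ, Fintype.card_fin, nsmul_eq_mul]
        have e1 : ∑ μ : Fin P.d, ((1 + P.eps * β) * δ₁ * Bι (Sum.inl μ) * Fb y y' + (1 + P.eps * β) * δ₁ * Bι (Sum.inr μ) * Fb y y')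
            = (∑ μ : Fin P.d, (1 + P.eps * β) * δ₁ * (Bι (Sum.inl μ) + Bι (Sum.inr μ))) * Fb y y' := by
          rw [Finset.sum_mul]; exact Finset.sum_congr rfl fun μ _ => by ring
        rw [e1]; ring

end Letter

end Summit.QuantumFields.BalabanUV.Gaps.D4WalkBlockSeedTerms

end
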